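import Summits.ABC.IUTFork.Cor312StatementSmallBadMassRealNV
import HarnessLib

/-!
# [IUTchIII] Cor. 3.12 — the typed Statement at `Real.settingPrVolSharp` under a BAD-MASS bound per prime
# (several bad places over one prime allowed): the (Ind1)-symmetrisation gain scales like `β_p^{j+1}`

PROOF-ONLY sequel (abc-iut cell, Cor. 3.12 cone, D-0067; seat abc-iut-w4-d006, gen 4) of `Cor312StatementSmallBadMassReal` /
`…NV` (p437008 / p438654). TAKES NO SIDE on [IUTchIII] Cor. 3.12; theorems only, 0 `def`s, no new `Prop` fact, no instance.
There the bad places were LONE over their primes. HERE several bad places over one (odd, unramified) prime are allowed; the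
gain is governed by the BAD MASS `β_p = Σ_{v ∈ S, v | p} n_v/[F:ℚ]` (Dupuy–Hilado §3.6), exactly as at the L-DH level
(abc-iut-c312-3 `cor312Of_of_badMass_le`, `LDHBadMassWindow` p428803):
* §1 `sum_prod_mul_last_fibre` — the product-weight bookkeeping `Σ_{v⃗} (Π_a f(v_a))·g(v_{i+1}) = (Σ f)^{i+1}·Σ f·g` over
  the `(i+2)`-tuples of places over `p` (split off the last coordinate, `Fin.snocEquiv`; `Finset.sum_pow'`).
* §2 **`thetaLocal_settingPrVolSharp_untopD_ge_of_badMass`** — at an odd `p ∤ disc(F)`, for Θ-ideles realising `P_Θ` (units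
  off `S`): `β^{i+1}·(Σ_{v|p} −P_{Θ,i+1}(v)·log N(v))/[F:ℚ] ≤ −|log(Θ)|_{i+1,p}` whenever `Σ_{v∈S, v|p} Pr(v) ≤ β` — in
  abc-iut-c312-5's closed form (p433308) a tuple with a GOOD coordinate has minimal exponent `0`, an all-bad tuple has
  minimal exponent `≤` that of its last coordinate, and the all-bad tuples weigh `Σ_{v⃗ all bad} Pr(v⃗)·m(v_{i+1}) =
  β_p^{i+1}·Σ_{v bad} Pr(v)·m(v)` (§1).
* §3 **`statement_settingPrVolSharp_of_badMass_le`** — if every bad place lies over an odd prime `p ∤ disc(F)`, the bad mass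
  of every such prime is `≤ β` and `Σ_{i<ℓ⋇} (i+1)²·β^{i+1} ≤ ℓ⋇`, then for Θ- and q-ideles realising `P_Θ`/`P_q` and ANY
  Thm-3.11 context the typed `Cor312.Setting.Statement` HOLDS at `Real.settingPrVolSharp` (per label: `Σ_{v_ℚ} −|log(Θ)|_{i+1,v_ℚ}
  ≥ β^{i+1}·(−deĝ(P_{Θ,i+1}))` by abc-iut-c312-7's `finsum_logvol_thetaRegion_sharp_Pr`, then `P_{Θ,j} = j²·P_q`);
  **`statement_settingPrVolSharp_of_badMass_le_half`** — `β = 1/2` works for EVERY `ℓ` (abc-iut-w5-d018 `sum_sq_half_pow_le`):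
  «every odd unramified bad prime carries at most half of the degree in bad places ⟹ the typed Statement holds».
HONEST SCOPE as in the parent files: F-PRESENTATION records (realising ideles do not exist at genuine F-level data, p432420;
over the print-faithful `K` every bad place is ramified, p436520); OUR sharp containers / typed (Ind1)(Ind2); packets over
`2·disc(F)` with a bad place not treated; nothing about `Cor22.Cor312AtDatum` or abc. [cite: DupuyHilado2025, §3.3, §3.6, §3.9,
§4.7] [claim: Mochizuki2012, status: disputed] typed ≠ proved; instantiated ≠ endorsed.
-/

noncomputable section

open Set Function NumberField IsDedekindDomain
open scoped Pointwise

namespace Summit.ABC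

namespace IUTFork

namespace Thm311

namespace Real

open Cor312 Cor312Vol Literature.IUT.LogThetaLattice Literature.IUT.LogVolume

variable {F : Type} [Field F] [NumberField F] (X : PilotData F) {logv : PadicLogs F} (hlog : LogvAnalytic logv)

/-! ## 1. Product-weight bookkeeping over tuples -/

/-- **Splitting off the last coordinate**: for weights `f` and a function `g` on a finite type,
`Σ_{e : Fin (k+1) → α} (Π_a f(e a))·g(e last) = (Σ f)^k·Σ_x f(x)·g(x)` — with the sum on the left taken for ANY `Fintype`
structure on the tuple type (abc-iut-c312-5's presentations use `Fintype.ofFinite`). [folklore] -/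
theorem sum_prod_mul_last {α : Type} [Fintype α] (k : ℕ) (inst : Fintype (Fin (k + 1) → α)) (f g : α → ℝ) :
    (@Finset.sum (Fin (k + 1) → α) ℝ _ (@Finset.univ _ inst) fun e => (∏ a, f (e a)) * g (e (Fin.last k))) =
      (∑ x, f x) ^ k * ∑ x, f x * g x := by
  classical
  have h1 : (@Finset.sum (Fin (k + 1) → α) ℝ _ (@Finset.univ _ inst) fun e => (∏ a, f (e a)) * g (e (Fin.last k))) =
      ∑ q : α × (Fin k → α), (∏ a, f (q.2 a)) * (f q.1 * g q.1) := by
    refine Fintype.sum_equiv (Fin.snocEquiv fun _ => α).symm _ _ fun e => ?_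
    -- `e = snoc (init e) (e last)`
    have he : (Fin.snocEquiv fun _ => α) ((Fin.snocEquiv fun _ => α).symm e) = e := Equiv.apply_symm_apply _ e
    conv_lhs => rw [← he]
    simp only [Fin.snocEquiv_apply, Fin.prod_univ_castSucc, Fin.snoc_castSucc, Fin.snoc_last]
    ring
  rw [h1, Fintype.sum_prod_type]
  simp only [← Finset.sum_mul]
  rw [← Finset.mul_sum]
  congr 1
  rw [Finset.sum_pow', Fintype.piFinset_univ]

/-! ## 2. Per prime: the gain under a bad-mass bound -/

section Sharp

variable (M : Type) [Field M] [NumberField M]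
  (archPk : ∀ (j : (thetaIndex X).Label) (vQ : (thetaIndex X).VQ), Set ((logShellsDH X logv).Packet j vQ))
  (archSub : ∀ (j : (thetaIndex X).Label) (v : (thetaIndex X).V),
    Set ((logShellsDH X logv).Packet j ((thetaIndex X).over v)))
  (Ψ : ℤ → ∀ v : (thetaIndex X).V, v ∈ (thetaIndex X).Vbad → Set ((logShellsDH X logv).StarPacket v))
  (act : ℤ → ∀ v : (thetaIndex X).V, v ∈ (thetaIndex X).Vbad →
    (logShellsDH X logv).StarPacket v → Module.End ℚ ((logShellsDH X logv).StarPacket v))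
  (Mmod : ℤ → ∀ j : (thetaIndex X).LabelStar, Set ((logShellsDH X logv).GlobalPacket j.1))
  (region : ℤ → ∀ j : (thetaIndex X).LabelStar, FinDivisor M → ∀ vQ : (thetaIndex X).VQ,
    Set ((logShellsDH X logv).Packet j.1 vQ))
  (n : ℤ) {HT : Type} {LogLink : HT → HT → Type} {IsFull : ∀ {s t : HT}, LogLink s t → Prop}
  (lat : LGPGaussianLogThetaLattice LogLink IsFull)
  {Frd : Type} {IsoF : Frd → Frd → Type} {Ob : Frd → Type} {realify : Frd → Frd} {Strip : Type}
  {IsoS : Strip → Strip → Type} {Mv : ∀ v : (thetaIndex X).V, v ∈ (thetaIndex X).Vbad → Type}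
  [∀ v h, Monoid (Mv v h)]
  (sig : GlobalLGPFrobenioidSignature (thetaIndex X).lstar (thetaIndex X).V (· ∈ (thetaIndex X).Vbad)
    Frd IsoF Ob realify Strip IsoS Mv)
  (split : SplittingMonoids Mv) {ObΔ : Type} {N : ∀ v : (thetaIndex X).V, v ∈ (thetaIndex X).Vbad → Type}
  [∀ v h, Monoid (N v h)] (qData : QPilotData ObΔ N)
  (t : ∀ (pp : Nat.Primes) (_ : Fin X.lstar) (x : (thetaIndex X).Fibre (.inr pp)),
    haveI : Fact (pp : ℕ).Prime := ⟨pp.2⟩; kOf X pp.1 x)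
  (tq : ∀ (pp : Nat.Primes) (x : (thetaIndex X).Fibre (.inr pp)), haveI : Fact (pp : ℕ).Prime := ⟨pp.2⟩; kOf X pp.1 x)
  (ht0 : ∀ pp i x, t pp i x ≠ 0)
  (ht1 : ∀ (pp : Nat.Primes) (i : Fin X.lstar) (x : (thetaIndex X).Fibre (.inr pp)),
    haveI : Fact (pp : ℕ).Prime := ⟨pp.2⟩; placeOf X pp.1 x ∉ X.S → ‖t pp i x‖ = 1)
  /- the Θ-ideles REALISE `P_Θ` in Dupuy–Hilado's normalisation (3.4) -/
  (ht : ∀ (pp : Nat.Primes) (i : Fin X.lstar) (x : (thetaIndex X).Fibre (.inr pp)),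
    haveI : Fact (pp : ℕ).Prime := ⟨pp.2⟩
    Real.log ‖t pp i x‖ = -(X.thetaPilot i (placeOf X pp.1 x)) * logNorm F (placeOf X pp.1 x) /
      localDegree F (placeOf X pp.1 x))
  (htq0 : ∀ pp x, tq pp x ≠ 0)
  (htq1 : ∀ (pp : Nat.Primes) (x : (thetaIndex X).Fibre (.inr pp)),
    haveI : Fact (pp : ℕ).Prime := ⟨pp.2⟩; placeOf X pp.1 x ∉ X.S → ‖tq pp x‖ = 1)


include ht0 ht1 ht in
open scoped Classical in
/-- **The (Ind1)-symmetrisation gain under a BAD-MASS bound, as a lower bound.** At an odd `p ∤ disc(F)`, for Θ-ideles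
realising `P_Θ` (units off `S`) and any `β ≥ Σ_{v∈S, v|p} Pr(v)`:
`β^{i+1}·(Σ_{v|p} −P_{Θ,i+1}(v)·log N(v))/[F:ℚ] ≤ −|log(Θ)|_{i+1,p}` at `Real.settingPrVolSharp`. In abc-iut-c312-5's closed form a
tuple with a good coordinate has minimal exponent `0`; an all-bad tuple `v⃗` has minimal exponent `≤ m(v_{i+1})` and the
all-bad tuples weigh `β_p^{i+1}·Σ_{v bad} Pr(v)·m(v)` (§1); `Pr(v)·m(v)·log p = P_{Θ,i+1}(v)·log N(v)/[F:ℚ]`.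
[cite: DupuyHilado2025, §3.6, §3.9, §4.7] [claim: Mochizuki2012, status: disputed] -/
theorem thetaLocal_settingPrVolSharp_untopD_ge_of_badMass (i : Fin (thetaIndex X).lstar) (pp : Nat.Primes)
    (hodd : 2 < (pp : ℕ)) (hunr : ¬ ((pp : ℕ) : ℤ) ∣ NumberField.discr F) {β : ℝ}
    (hβ : haveI : Fact (pp : ℕ).Prime := ⟨pp.2⟩; (∑ v ∈ (placesOver F pp.1).filter (· ∈ X.S), weight F v) ≤ β) :
    β ^ ((i : ℕ) + 1) * ((∑ v ∈ (haveI : Fact (pp : ℕ).Prime := ⟨pp.2⟩; placesOver F pp.1),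
        -(X.thetaPilot i v) * logNorm F v) / Module.finrank ℚ F) ≤
      ((settingPrVolSharp X hlog M archPk archSub Ψ act Mmod region n lat sig split qData tq t htq0 htq1).thetaLocal
        (Setting.labelSucc i) (.inr pp)).untopD 0 := by
  classical
  haveI : Fact (pp : ℕ).Prime := ⟨pp.2⟩
  haveI : Fintype ((thetaIndex X).Fibre (.inr pp)) := Fintype.ofFinite _
  have he := absRamificationIdx_presAt_eq_one X hlog pp hunr
  choose m hm using fun x : (thetaIndex X).Fibre (.inr pp) =>
    exists_norm_eq_norm_padic_zpow (pp : ℕ) ((presAt X hlog pp).k x) (he x) (ht0 pp i x)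
  have hm' : ∀ x : (thetaIndex X).Fibre (.inr pp), ‖t pp i x‖ = ‖((pp : ℕ) : ℚ_[pp]) ^ m x‖ := fun x => hm x
  have hp1 : 1 < ((pp : ℕ) : ℝ) := by exact_mod_cast pp.2.one_lt
  have hlogp : 0 ≤ Real.log (pp : ℕ) := Real.log_nonneg hp1.le
  have hd : (0 : ℝ) < (Module.finrank ℚ F : ℝ) := by exact_mod_cast Module.finrank_pos
  -- at a good coordinate the exponent vanishes
  have hgood : ∀ x : (thetaIndex X).Fibre (.inr pp), placeOf X pp.1 x ∉ X.S → m x = 0 := by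
    intro x hx
    have h1 : ‖((pp : ℕ) : ℚ_[pp]) ^ m x‖ = 1 := (hm' x).symm.trans (ht1 pp i x hx)
    rw [norm_zpow, Padic.norm_p] at h1
    have hp0 : (0 : ℝ) ≤ ((pp : ℕ) : ℝ)⁻¹ := inv_nonneg.mpr (by positivity)
    have hp1' : ((pp : ℕ) : ℝ)⁻¹ ≠ 1 := by
      rw [Ne, inv_eq_one]; exact ne_of_gt hp1
    exact (zpow_eq_one_iff_right₀ hp0 hp1').mp h1
  -- the exponent in terms of the Θ-pilot: `m(x)·log p = P_{Θ,i+1}(v_x)·log N(v_x)/n_{v_x}`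
  have hmlog : ∀ x : (thetaIndex X).Fibre (.inr pp), ((m x : ℤ) : ℝ) * Real.log (pp : ℕ) =
      X.thetaPilot i (placeOf X pp.1 x) * logNorm F (placeOf X pp.1 x) / localDegree F (placeOf X pp.1 x) := by
    intro x
    have hA : Real.log ‖((pp : ℕ) : ℚ_[pp]) ^ m x‖ = -(((m x : ℤ) : ℝ) * Real.log (pp : ℕ)) := by
      rw [norm_zpow, Padic.norm_p, Real.log_zpow, Real.log_inv]; ring
    have hB : Real.log ‖((pp : ℕ) : ℚ_[pp]) ^ m x‖ =
        -(X.thetaPilot i (placeOf X pp.1 x)) * logNorm F (placeOf X pp.1 x) / localDegree F (placeOf X pp.1 x) :=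
      (congrArg Real.log (hm' x)).symm.trans (ht pp i x)
    have hC : -(X.thetaPilot i (placeOf X pp.1 x)) * logNorm F (placeOf X pp.1 x) / localDegree F (placeOf X pp.1 x) =
        -(X.thetaPilot i (placeOf X pp.1 x) * logNorm F (placeOf X pp.1 x) / localDegree F (placeOf X pp.1 x)) := by
      ring
    linarith
  -- the indicator weights `f(x) = Pr(v_x)·𝟙[v_x ∈ S]`
  set f : (thetaIndex X).Fibre (.inr pp) → ℝ := fun x =>
    if placeOf X pp.1 x ∈ X.S then weight F (placeOf X pp.1 x) else 0 with hf
  have hf0 : ∀ x, 0 ≤ f x := fun x => by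
    rw [hf]; dsimp only; split_ifs
    · exact weight_nonneg F _
    · exact le_refl 0
  -- `Σ_x f(x) = Σ_{v ∈ S, v|p} Pr(v) ≤ β`
  have hsumf : ∑ x, f x = ∑ v ∈ (placesOver F pp.1).filter (· ∈ X.S), weight F v := by
    rw [Finset.sum_filter, ← Finset.sum_coe_sort (placesOver F pp.1)]
    exact Fintype.sum_equiv (fibreEquivPlacesOver X pp) _ _ fun x => rfl
  have hfβ : ∑ x, f x ≤ β := hsumf ▸ hβ
  have hf0' : 0 ≤ ∑ x, f x := Finset.sum_nonneg fun x _ => hf0 x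
  -- `Σ_x f(x)·m(x)·log p = Σ_{v|p} P_{Θ,i+1}(v)·log N(v)/[F:ℚ]`
  have hsumfm : ∑ x, f x * (((m x : ℤ) : ℝ) * Real.log (pp : ℕ)) =
      (∑ v ∈ placesOver F pp.1, X.thetaPilot i v * logNorm F v) / Module.finrank ℚ F := by
    rw [Finset.sum_div, ← Finset.sum_coe_sort (placesOver F pp.1)]
    refine Fintype.sum_equiv (fibreEquivPlacesOver X pp) _ _ fun x => ?_
    show f x * (((m x : ℤ) : ℝ) * Real.log (pp : ℕ)) =
      X.thetaPilot i (placeOf X pp.1 x) * logNorm F (placeOf X pp.1 x) / Module.finrank ℚ F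
    rw [hmlog x, hf]
    dsimp only
    split_ifs with hx
    · have hn : (localDegree F (placeOf X pp.1 x) : ℝ) ≠ 0 := by exact_mod_cast (localDegree_pos F _).ne'
      unfold weight
      field_simp
    · have hθ : X.thetaPilot i (placeOf X pp.1 x) = 0 := by
        simp only [PilotData.thetaPilot, FinDivisor.of, Finsupp.finsetSum_apply, Finsupp.single_apply,
          Finset.sum_ite_eq', if_neg hx]
      rw [hθ]; ring
  -- the closed form of abc-iut-c312-5
  rw [thetaLocal_settingPrVolSharp_eq_of_zpow X hlog M archPk archSub Ψ act Mmod region n t tq lat sig split qData ht0 htq0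
    htq1 i pp hodd hunr m hm, WithTop.untopD_coe]
  -- termwise: `−(Π_a f(v_a))·m(v_{i+1})·log p ≤ Pr(v⃗)·(−min_a m(v_a)·log p)`
  have hterm : ∀ e : (presAt X hlog pp).toLocalPieces.E (Setting.labelSucc i),
      -((∏ a, f (e a)) * (((m (e (Fin.last _)) : ℤ) : ℝ) * Real.log (pp : ℕ))) ≤
        weightPr X pp.1 (Setting.labelSucc i) e *
          (-(Finset.univ.inf' Finset.univ_nonempty (fun a => m (e a)) * Real.log (pp : ℕ))) := by
    intro e
    by_cases hall : ∀ a, placeOf X pp.1 (e a) ∈ X.S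
    · have hprod : ∏ a, f (e a) = weightPr X pp.1 (Setting.labelSucc i) e := by
        unfold weightPr
        exact Finset.prod_congr rfl fun a _ => by rw [hf]; exact if_pos (hall a)
      rw [hprod]
      have hinf : ((Finset.univ.inf' Finset.univ_nonempty (fun a => m (e a)) : ℤ) : ℝ) ≤ ((m (e (Fin.last _)) : ℤ) : ℝ) := by
        exact_mod_cast Finset.inf'_le (fun a => m (e a)) (Finset.mem_univ (Fin.last _))
      have := mul_nonneg (mul_nonneg (weightPr_nonneg X pp.1 _ e) hlogp) (sub_nonneg.mpr hinf)
      nlinarith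
    · obtain ⟨a₀, ha₀⟩ : ∃ a, placeOf X pp.1 (e a) ∉ X.S := not_forall.mp hall
      have hz : ∏ a, f (e a) = 0 :=
        Finset.prod_eq_zero (Finset.mem_univ a₀) (by rw [hf]; exact if_neg ha₀)
      rw [hz, zero_mul, neg_zero]
      have hma : m (e a₀) = 0 := hgood (e a₀) ha₀
      have hinf : Finset.univ.inf' Finset.univ_nonempty (fun a => m (e a)) ≤ 0 :=
        (Finset.inf'_le (fun a => m (e a)) (Finset.mem_univ a₀)).trans_eq hma
      have hinfR : ((Finset.univ.inf' Finset.univ_nonempty (fun a => m (e a)) : ℤ) : ℝ) ≤ 0 := by exact_mod_cast hinf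
      exact mul_nonneg (weightPr_nonneg X pp.1 _ e) (neg_nonneg.mpr (mul_nonpos_of_nonpos_of_nonneg hinfR hlogp))
  -- sum the termwise bounds and evaluate the left side by §1
  have hsum := Finset.sum_le_sum fun e (_ : e ∈ Finset.univ) => hterm e
  rw [Finset.sum_neg_distrib] at hsum
  have hkey := sum_prod_mul_last ((i : ℕ) + 1) ((presAt X hlog pp).toLocalPieces.instFintype (Setting.labelSucc i)) f
    (fun x => ((m x : ℤ) : ℝ) * Real.log (pp : ℕ))
  have hkey' : (∑ e : (presAt X hlog pp).toLocalPieces.E (Setting.labelSucc i),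
      (∏ a, f (e a)) * (((m (e (Fin.last _)) : ℤ) : ℝ) * Real.log (pp : ℕ))) =
      (∑ x, f x) ^ ((i : ℕ) + 1) * ((∑ v ∈ placesOver F pp.1, X.thetaPilot i v * logNorm F v) / Module.finrank ℚ F) := by
    rw [← hsumfm]; exact hkey
  rw [hkey'] at hsum
  -- compare `β^{i+1}` with `(Σ f)^{i+1}` against the nonpositive factor
  have hA : 0 ≤ (∑ v ∈ placesOver F pp.1, X.thetaPilot i v * logNorm F v) / Module.finrank ℚ F := by
    refine div_nonneg (Finset.sum_nonneg fun v _ => mul_nonneg ?_ (logNorm_pos F v).le) hd.le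
    by_cases hv : v ∈ X.S
    · simp only [PilotData.thetaPilot, FinDivisor.of, Finsupp.finsetSum_apply, Finsupp.single_apply,
        Finset.sum_ite_eq', if_pos hv]
      exact div_nonneg (mul_nonneg (by positivity) (by exact_mod_cast (X.ordq_pos hv).le)) X.two_mul_l_pos.le
    · simp only [PilotData.thetaPilot, FinDivisor.of, Finsupp.finsetSum_apply, Finsupp.single_apply,
        Finset.sum_ite_eq', if_neg hv]; exact le_refl 0
  have hpow : (∑ x, f x) ^ ((i : ℕ) + 1) ≤ β ^ ((i : ℕ) + 1) := pow_le_pow_left₀ hf0' hfβ _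
  have hneg : (∑ v ∈ placesOver F pp.1, -(X.thetaPilot i v) * logNorm F v) / Module.finrank ℚ F =
      -((∑ v ∈ placesOver F pp.1, X.thetaPilot i v * logNorm F v) / Module.finrank ℚ F) := by
    rw [← neg_div, ← Finset.sum_neg_distrib]
    refine congrArg (· / _) (Finset.sum_congr rfl fun v _ => by ring)
  rw [hneg]
  nlinarith [mul_le_mul_of_nonneg_right hpow hA]

/-! ## 3. The typed Statement under a bad-mass bound -/

include ht0 ht1 ht in
open scoped Classical in
/-- **THE TYPED STATEMENT OF [IUTchIII] COR. 3.12 HOLDS AT `Real.settingPrVolSharp` UNDER A BAD-MASS BOUND.** If every bad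
place `v ∈ S` lies over an odd prime `p ∤ disc(F)`, the bad mass `Σ_{w∈S, w|p} n_w/[F:ℚ]` of every such prime is `≤ β`,
and `Σ_{i<ℓ⋇} (i+1)²·β^{i+1} ≤ ℓ⋇`, then for Θ- and q-pilot ideles realising `P_Θ`/`P_q` (non-zero, units off `S`) and
ANY Thm-3.11 context binders the printed Statement holds at the print-normalised sharp real setting — several bad places over
one prime allowed. Per label `Σ_{v_ℚ} −|log(Θ)|_{i+1,v_ℚ} ≥ β^{i+1}·(−deĝ(P_{Θ,i+1}))` (§2 at the primes under `S`; region `≤` hull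
elsewhere; abc-iut-c312-7 `finsum_logvol_thetaRegion_sharp_Pr`), then `deĝ(P_{Θ,i+1}) = (i+1)²·deĝ(P_q)`. F-PRESENTATION record
(module docstring). [cite: DupuyHilado2025, §3.3, §3.6, §3.9, §4.7] [claim: Mochizuki2012, status: disputed] -/
theorem statement_settingPrVolSharp_of_badMass_le
    (htq : ∀ (pp : Nat.Primes) (x : (thetaIndex X).Fibre (.inr pp)),
      haveI : Fact (pp : ℕ).Prime := ⟨pp.2⟩
      Real.log ‖tq pp x‖ = -(X.qPilot (placeOf X pp.1 x)) * logNorm F (placeOf X pp.1 x) /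
        localDegree F (placeOf X pp.1 x))
    (hodd : ∀ v ∈ X.S, 2 < residueChar F v)
    (hunr : ∀ v ∈ X.S, ¬ ((residueChar F v : ℕ) : ℤ) ∣ NumberField.discr F)
    {β : ℝ}
    (hβ : ∀ v ∈ X.S, haveI : Fact (residueChar F v).Prime := ⟨residueChar_prime F v⟩
      (∑ w ∈ (placesOver F (residueChar F v)).filter (· ∈ X.S), weight F w) ≤ β)
    (hmass : ∑ i : Fin X.lstar, (((i : ℕ) : ℝ) + 1) ^ 2 * β ^ ((i : ℕ) + 1) ≤ (X.lstar : ℝ)) :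
    (settingPrVolSharp X hlog M archPk archSub Ψ act Mmod region n lat sig split qData tq t htq0 htq1).Statement := by
  classical
  rw [statement_settingPrVolSharp_iff X hlog M archPk archSub Ψ act Mmod region n lat sig split qData t tq ht0 ht1 htq0
    htq1 htq]
  have hfin := thetaFinite_settingPrVolSharp X hlog M archPk archSub Ψ act Mmod region n lat sig split qData t tq ht0 ht1
    htq0 htq1
  have hadm := thetaRegionsAdm_settingPrVolSharp X hlog M archPk archSub Ψ act Mmod region n lat sig split qData t tq ht0
    htq0 htq1
  have hmono := logvolMono_settingPrVol X hlog M archPk archSub Ψ act Mmod region n lat sig split qData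
    (fun _ _ => thetaBoxDH X hlog (sharpBoxDH X hlog t)) (fun _ => qCentreDH X hlog tq)
    (qCentreDH_ne_zero X hlog tq htq0)
    (finite_support_logvol_qRegion_Pr X hlog M archPk archSub Ψ act Mmod region n tq htq0 htq1)
  unfold Setting.negLogTheta
  rw [if_pos hfin, WithTop.coe_le_coe]
  have hd : (0 : ℝ) < (Module.finrank ℚ F : ℝ) := by exact_mod_cast Module.finrank_pos
  have hl : (0 : ℝ) < (X.lstar : ℝ) := by
    have := X.two_le_lstar
    exact_mod_cast (by omega : 0 < X.lstar)
  -- per label: `β^{i+1}·(−deĝ(P_{Θ,i+1})) ≤ Σ_{v_ℚ} −|log(Θ)|_{i+1,v_ℚ}`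
  have hlabel : ∀ i : Fin (thetaIndex X).lstar,
      β ^ ((i : ℕ) + 1) * (-FinDivisor.ndeg F (X.thetaPilot i)) ≤
        ∑ᶠ vQ : (thetaIndex X).VQ, ((settingPrVolSharp X hlog M archPk archSub Ψ act Mmod region n lat sig split qData tq t htq0 htq1).thetaLocal
          (Setting.labelSucc i) vQ).untopD 0 := by
    intro i
    -- the region volumes: pointwise lower bound `β^{i+1}·(region volume) ≤ (hull volume)`
    set r : (thetaIndex X).VQ → ℝ := fun vQ =>
      ((situationPrVol X hlog M archPk archSub Ψ act Mmod region).D n).logvol (Setting.labelSucc i) vQ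
        ((settingPrVolSharp X hlog M archPk archSub Ψ act Mmod region n lat sig split qData tq t htq0 htq1).thetaRegion 0
          (Setting.labelSucc i) vQ) with hr
    have hreg : ∀ vQ, r vQ ≤ ((settingPrVolSharp X hlog M archPk archSub Ψ act Mmod region n lat sig split qData tq t htq0 htq1).thetaLocal
          (Setting.labelSucc i) vQ).untopD 0 :=
      fun vQ => logvol_thetaRegion_le_thetaLocal_of_mono hmono hfin hadm 0 i vQ
    have hsupp := support_logvol_thetaRegion_sharp_Pr_subset X hlog M archPk archSub Ψ act Mmod region n lat sig split
      qData t ht0 ht (fun _ => qCentreDH X hlog tq) (qCentreDH_ne_zero X hlog tq htq0)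
      (finite_support_logvol_qRegion_Pr X hlog M archPk archSub Ψ act Mmod region n tq htq0 htq1) 0 i
    have hrfin : (Function.support r).Finite :=
      finite_support_logvol_thetaRegion_sharp_Pr X hlog M archPk archSub Ψ act Mmod region n lat sig split qData t ht0 ht
        _ _ _ 0 i
    have hrsum : ∑ᶠ vQ, r vQ = -FinDivisor.ndeg F (X.thetaPilot i) :=
      finsum_logvol_thetaRegion_sharp_Pr X hlog M archPk archSub Ψ act Mmod region n lat sig split qData t ht0 ht _ _ _ 0 i
    have hpt : ∀ vQ, β ^ ((i : ℕ) + 1) * r vQ ≤ ((settingPrVolSharp X hlog M archPk archSub Ψ act Mmod region n lat sig split qData tq t htq0 htq1).thetaLocal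
          (Setting.labelSucc i) vQ).untopD 0 := by
      intro vQ
      by_cases h0 : r vQ = 0
      · rw [h0, mul_zero]; exact h0.symm.le.trans (hreg vQ)
      · -- `vQ` is a prime under a bad place: §2
        have hmem := hsupp (Function.mem_support.mpr h0)
        rw [Finset.mem_coe, Finset.mem_image] at hmem
        obtain ⟨v, hv, hvQ⟩ := hmem
        have hvS : v ∈ X.S := by
          by_contra hvS
          refine (Finsupp.mem_support_iff.mp hv) ?_
          simp only [PilotData.thetaPilot, FinDivisor.of, Finsupp.finsetSum_apply, Finsupp.single_apply,
            Finset.sum_ite_eq', if_neg hvS]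
        subst hvQ
        let pp : Nat.Primes := ⟨residueChar F v, residueChar_prime F v⟩
        haveI : Fact (pp : ℕ).Prime := ⟨pp.2⟩
        have hover : (thetaIndex X).over (.inr v : Place F) = .inr pp := rfl
        have h2 := thetaLocal_settingPrVolSharp_untopD_ge_of_badMass X hlog M archPk archSub Ψ act Mmod region n lat sig
          split qData t tq ht0 ht1 ht htq0 htq1 i pp (hodd v hvS) (hunr v hvS) (hβ v hvS)
        rw [hover]
        have hval := logvol_thetaRegion_sharp_Pr_inr X hlog M archPk archSub Ψ act Mmod region n lat sig split qData t ht0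
          ht (fun _ => qCentreDH X hlog tq) (qCentreDH_ne_zero X hlog tq htq0)
          (finite_support_logvol_qRegion_Pr X hlog M archPk archSub Ψ act Mmod region n tq htq0 htq1) 0 i pp
        refine le_trans (le_of_eq ?_) h2
        rw [hr]
        exact congrArg (fun z : ℝ => β ^ ((i : ℕ) + 1) * z) hval
    calc β ^ ((i : ℕ) + 1) * (-FinDivisor.ndeg F (X.thetaPilot i)) = ∑ᶠ vQ, β ^ ((i : ℕ) + 1) * r vQ := by
          rw [← hrsum, mul_finsum]
      _ ≤ ∑ᶠ vQ, ((settingPrVolSharp X hlog M archPk archSub Ψ act Mmod region n lat sig split qData tq t htq0 htq1).thetaLocal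
          (Setting.labelSucc i) vQ).untopD 0 :=
          finsum_le_finsum' (hrfin.subset (Function.support_mul_subset_right _ _)) (hfin.2 i) hpt
  -- assemble over the labels
  calc -FinDivisor.ndeg F X.qPilot
      ≤ processionNormalized (fun i : Fin X.lstar => β ^ ((i : ℕ) + 1) * (-FinDivisor.ndeg F (X.thetaPilot i))) := by
        unfold processionNormalized
        rw [le_div_iff₀ hl]
        have hθdeg : ∀ i : Fin X.lstar, FinDivisor.ndeg F (X.thetaPilot i) =
            (((i : ℕ) : ℝ) + 1) ^ 2 * FinDivisor.ndeg F X.qPilot := fun i => by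
          rw [FinDivisor.ndeg_apply, FinDivisor.ndeg_apply, X.deg_thetaPilot, mul_div_assoc]
        simp_rw [hθdeg]
        have hq : 0 ≤ FinDivisor.ndeg F X.qPilot := by
          rw [FinDivisor.ndeg_apply]; exact div_nonneg X.deg_qPilot_pos.le hd.le
        have : ∑ i : Fin X.lstar, β ^ ((i : ℕ) + 1) * -((((i : ℕ) : ℝ) + 1) ^ 2 * FinDivisor.ndeg F X.qPilot) =
            -(FinDivisor.ndeg F X.qPilot) * ∑ i : Fin X.lstar, (((i : ℕ) : ℝ) + 1) ^ 2 * β ^ ((i : ℕ) + 1) := by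
          rw [Finset.mul_sum]; exact Finset.sum_congr rfl fun i _ => by ring
        rw [this]
        nlinarith [mul_le_mul_of_nonneg_left hmass hq]
    _ ≤ processionNormalized (fun i : Fin (thetaIndex X).lstar => ∑ᶠ vQ : (thetaIndex X).VQ,
          ((settingPrVolSharp X hlog M archPk archSub Ψ act Mmod region n lat sig split qData tq t htq0 htq1).thetaLocal
          (Setting.labelSucc i) vQ).untopD 0) :=
        processionNormalized_mono fun i => hlabel i

include ht0 ht1 ht in
open scoped Classical in
/-- **Bad mass `≤ 1/2` suffices, for every `ℓ`** (abc-iut-w5-d018 `sum_sq_half_pow_le`): if every bad place lies over an odd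
prime `p ∤ disc(F)` whose bad places carry at most HALF of the degree (`Σ_{w∈S, w|p} n_w ≤ [F:ℚ]/2`), the typed Statement
holds at `Real.settingPrVolSharp` (realising ideles, any context, every depth). F-PRESENTATION record.
[cite: DupuyHilado2025, §3.3, §3.6] [claim: Mochizuki2012, status: disputed] -/
theorem statement_settingPrVolSharp_of_badMass_le_half
    (htq : ∀ (pp : Nat.Primes) (x : (thetaIndex X).Fibre (.inr pp)),
      haveI : Fact (pp : ℕ).Prime := ⟨pp.2⟩
      Real.log ‖tq pp x‖ = -(X.qPilot (placeOf X pp.1 x)) * logNorm F (placeOf X pp.1 x) /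
        localDegree F (placeOf X pp.1 x))
    (hodd : ∀ v ∈ X.S, 2 < residueChar F v)
    (hunr : ∀ v ∈ X.S, ¬ ((residueChar F v : ℕ) : ℤ) ∣ NumberField.discr F)
    (hhalf : ∀ v ∈ X.S, haveI : Fact (residueChar F v).Prime := ⟨residueChar_prime F v⟩
      (∑ w ∈ (placesOver F (residueChar F v)).filter (· ∈ X.S), weight F w) ≤ 1 / 2) :
    (settingPrVolSharp X hlog M archPk archSub Ψ act Mmod region n lat sig split qData tq t htq0 htq1).Statement :=
  statement_settingPrVolSharp_of_badMass_le X hlog M archPk archSub Ψ act Mmod region n lat sig split qData t tq ht0 ht1 ht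
    htq0 htq1 htq hodd hunr hhalf (SplitBadPrime.sum_sq_half_pow_le X.lstar)

end Sharp

end Real

end Thm311

end IUTFork

end Summit.ABC

end
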